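import Literature.MathematicalPhysics.QuantumManyBody.PeriodicFormCoreTrigPoly
import Literature.MathematicalPhysics.QuantumManyBody.PeriodicSmoothPairCutoff
import Literature.Analysis.FunctionSpaces.TorusPairCutoffSymmetry
import HarnessLib

/-!
# Multiplying a core function by the smooth hard-core cut-off

`Literature/MathematicalPhysics/QuantumManyBody` support file (everything proved; no definitions, no
named facts), namespace `Literature.MathematicalPhysics.QuantumManyBody.BoseGas`, Haar-probability
convention of `PeriodicFormDomain` (local instances). The glue between the smooth pair cut-off
`χ̃ = Torus.pairCutoff Torus.smoothCutProfile r δ` (`PeriodicSmoothPairCutoff`: `χ̃ ∘ toUnitTorusN L`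
is `C^∞`, periodic and Bose-symmetric) and the form core `periodicCore N L` of `C¹` periodic
Bose-symmetric functions with its embedding `ι = formEmbed ∘ graphEmbed` into `L²((ℝ/ℤ)^{3N})`
(`PeriodicFormDomain`, `PeriodicFormCoreTrigPoly`):

* `mul_mem_periodicCore` — the core is closed under pointwise products;
* `pairCutoff_toUnitTorusN_comp_perm` — `χ̃ ∘ toUnitTorusN L` is symmetric under permutations of the
  particles (`Torus.pairCutoff_comp_perm` of `TorusPairCutoffSymmetry`);
* `pairCutoff_toUnitTorusN_mem_periodicCore` — `X ↦ χ̃(toUnitTorusN L X)` (as a complex function) is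
  a core function (`0 < δ`, `0 ≤ r`, `r + 2δ < 1/2`, `L ≠ 0`);
* `exists_core_coeFn_eq_pairCutoff_mul` — **for every core function `Ψ` there is a core function `Φ`
  (namely `(χ̃ ∘ toUnitTorusN L) · Ψ`) with `ιΦ = χ̃ · ιΨ` a.e. on the torus.**

Combined with `exists_core_formEmbed_eq_sum_smul` (every Bose-symmetric trigonometric polynomial is
`ιΨ` for a core `Ψ`) and the core variational principle
`periodicGroundStateEnergy_mul_le_maxForm_core` — whose physical profile `w` is arbitrary, the
auxiliary `(v, hW)` only building `ι` — this makes `χ̃ · P` an admissible trial state for the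
hard-core Bose gas, for every Bose-symmetric trigonometric polynomial `P`.

## Mathlib / tree search

Tree: `periodicCore`, `mem_periodicCore`, `coeFn_formEmbed_graphEmbed`, `toUnitTorusN_fromUnitTorusN`,
`contDiff_pairCutoff_toUnitTorusN`, `isTorusPeriodic_pairCutoff_toUnitTorusN` (`PeriodicSmoothPairCutoff`),
`Torus.pairCutoff_comp_perm` (`TorusPairCutoffSymmetry`), `toUnitTorusN_apply` (`PeriodicConfigFourier`).
-/

noncomputable section

open MeasureTheory Filter Set Complex UnitAddTorus
open scoped ENNReal NNReal Topology InnerProductSpace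
open Literature.Analysis.FunctionSpaces

namespace Literature.MathematicalPhysics.QuantumManyBody.BoseGas

-- The measure on `ℝ/ℤ` is the Haar PROBABILITY measure, as in `PeriodicFormDomain.lean`.
attribute [local instance] formDomain_measureSpace formDomain_isProbabilityMeasure formDomain_isProbabilityMeasure_pi

variable {N : ℕ} {L : ℝ} {v : ℝ → ℝ≥0∞}

/-! ## Bose symmetry of the cut-off read on configurations -/

/-- Relabelling the particles relabels the torus point: `toUnitTorusN L (X ∘ σ) (i, k) = toUnitTorusN L X (σ i, k)`.
[folklore] -/
theorem toUnitTorusN_comp_perm_apply (L : ℝ) (X : Config N) (σ : Equiv.Perm (Fin N)) (p : Fin N × Fin 3) :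
    toUnitTorusN L (X ∘ σ) p = toUnitTorusN L X (σ p.1, p.2) := by
  rw [toUnitTorusN_apply, toUnitTorusN_apply, Function.comp_apply]

/-- **Bose symmetry**: `χ(toUnitTorusN L (X ∘ σ)) = χ(toUnitTorusN L X)` for every permutation `σ`
of the particles (any profile; `ρᵢⱼ = ρⱼᵢ`). [folklore] -/
theorem pairCutoff_toUnitTorusN_comp_perm (L : ℝ) (θ : ℝ → ℝ) (r δ : ℝ) (X : Config N) (σ : Equiv.Perm (Fin N)) :
    Torus.pairCutoff θ r δ (toUnitTorusN L (X ∘ σ)) = Torus.pairCutoff θ r δ (toUnitTorusN L X) := by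
  have h : toUnitTorusN L (X ∘ σ) = fun p : Fin N × Fin 3 => toUnitTorusN L X (σ p.1, p.2) :=
    funext fun p => toUnitTorusN_comp_perm_apply L X σ p
  rw [h]
  exact Torus.pairCutoff_comp_perm θ r δ _ σ

/-! ## Products of core functions -/

/-- **The form core is closed under pointwise products.** [folklore] -/
theorem mul_mem_periodicCore {Ψ Φ : Config N → ℂ} (hΨ : Ψ ∈ periodicCore N L) (hΦ : Φ ∈ periodicCore N L) :
    Ψ * Φ ∈ periodicCore N L := by
  rw [mem_periodicCore] at hΨ hΦ ⊢
  refine ⟨hΨ.1.mul hΦ.1, fun X i k => ?_, fun σ X => ?_⟩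
  · simp only [Pi.mul_apply, hΨ.2.1 X i k, hΦ.2.1 X i k]
  · simp only [Pi.mul_apply, hΨ.2.2 σ X, hΦ.2.2 σ X]

/-- **The smooth pair cut-off read on configurations is a core function**: `C¹` (indeed `C^∞`),
`Lℤ³`-periodic in every particle, Bose-symmetric (`0 < δ`, `0 ≤ r`, `r + 2δ < 1/2`, `L ≠ 0`).
[folklore] -/
theorem pairCutoff_toUnitTorusN_mem_periodicCore (hL : L ≠ 0) {r δ : ℝ} (hδ : 0 < δ) (hr : 0 ≤ r)
    (h2 : r + 2 * δ < 1 / 2) :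
    (fun X : Config N => ((Torus.pairCutoff Torus.smoothCutProfile r δ (toUnitTorusN L X) : ℝ) : ℂ)) ∈
      periodicCore N L := by
  rw [mem_periodicCore]
  refine ⟨?_, fun X i k => ?_, fun σ X => ?_⟩
  · exact ofRealCLM.contDiff.comp ((contDiff_pairCutoff_toUnitTorusN L hδ hr h2 (n := 1)))
  · simp only [isTorusPeriodic_pairCutoff_toUnitTorusN hL Torus.smoothCutProfile r δ X i k]
  · simp only [pairCutoff_toUnitTorusN_comp_perm]

/-! ## The embedded class of the product -/

section Embed

variable (hL : 0 < L) (hv : Measurable v) (hW : ∫⁻ X in cellN N L, periodicInteraction v L X ≠ ⊤)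

/-- Local notation for the Hilbert space `L²((ℝ/ℤ)^{3N})`, as in `PeriodicFormDomain.lean`. -/
local notation "L2T " N':max => Lp ℂ 2 (volume : Measure (UnitAddTorus (Fin N' × Fin 3)))

/-- **Multiplying a core function by the smooth cut-off multiplies its embedded class**: for every
core function `Ψ` and `0 < δ`, `0 ≤ r`, `r + 2δ < 1/2`, there is a core function `Φ` with
`ιΦ = χ̃ · ιΨ` a.e., `χ̃ = Torus.pairCutoff smoothCutProfile r δ`. [folklore] -/
theorem exists_core_coeFn_eq_pairCutoff_mul (Ψ : periodicCore N L) {r δ : ℝ} (hδ : 0 < δ) (hr : 0 ≤ r)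
    (h2 : r + 2 * δ < 1 / 2) :
    ∃ Φ : periodicCore N L,
      (formEmbed hL hv hW ⟨graphEmbed hL hv hW Φ, graphEmbed_mem_formDomain hL hv hW Φ⟩ :
          UnitAddTorus (Fin N × Fin 3) → ℂ) =ᵐ[volume]
        fun t => (Torus.pairCutoff Torus.smoothCutProfile r δ t : ℂ) *
          (formEmbed hL hv hW ⟨graphEmbed hL hv hW Ψ, graphEmbed_mem_formDomain hL hv hW Ψ⟩ :
            UnitAddTorus (Fin N × Fin 3) → ℂ) t := by
  set χc : Config N → ℂ := fun X => ((Torus.pairCutoff Torus.smoothCutProfile r δ (toUnitTorusN L X) : ℝ) : ℂ)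
    with hχc
  have hχmem : χc ∈ periodicCore N L := pairCutoff_toUnitTorusN_mem_periodicCore hL.ne' hδ hr h2
  refine ⟨⟨χc * (Ψ : Config N → ℂ), mul_mem_periodicCore hχmem Ψ.2⟩, ?_⟩
  filter_upwards [coeFn_formEmbed_graphEmbed hL hv hW ⟨χc * (Ψ : Config N → ℂ), mul_mem_periodicCore hχmem Ψ.2⟩,
    coeFn_formEmbed_graphEmbed hL hv hW Ψ] with t h1 h2'
  rw [h1, h2']
  simp only [Pi.mul_apply, hχc, toUnitTorusN_fromUnitTorusN hL.ne']
  ring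

/-- The embedded class of the product is pointwise dominated: `‖ιΦ‖ ≤ ‖ιΨ‖` a.e. (`0 ≤ χ̃ ≤ 1`).
[folklore] -/
theorem norm_pairCutoff_mul_le {r δ : ℝ} (t : UnitAddTorus (Fin N × Fin 3)) (z : ℂ) :
    ‖(Torus.pairCutoff Torus.smoothCutProfile r δ t : ℂ) * z‖ ≤ ‖z‖ := by
  obtain ⟨K, hK⟩ := Torus.exists_isCutProfile_smoothCutProfile
  rw [norm_mul, Complex.norm_real, Real.norm_eq_abs]
  exact mul_le_of_le_one_left (norm_nonneg _) (Torus.abs_pairCutoff_le_one hK r δ t)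

end Embed

end Literature.MathematicalPhysics.QuantumManyBody.BoseGas

end
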